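import Literature.NumberTheory.Automorphic.SchwartzBruhatL2Pairing     -- ★ `IsL2Isometric.integral_mul_conj_apply`, `integrable_mul_conj`, `integral_mul_conj_self_eq_toReal_l2NormSq` (+ ★ `l2NormSq_pos`, `l2NormSq_ne_top`, `IsL2Isometric`)
import Literature.NumberTheory.Automorphic.MatrixCoefficients          -- ★ `Representation.IsUnitarizable` (invariant positive-definite Hermitian form, no completion)
import HarnessLib

/-!
# An `L²`-isometric action on `𝒮(X)` is UNITARIZABLE: the `L²(ν)` pairing is an invariant positive-definite Hermitian form

Topic `NumberTheory/Automorphic`; namespace `Literature.NumberTheory.Automorphic` (continuing ★ `SchwartzBruhatL2Norm`, ★ `SchwartzBruhatL2Pairing`).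
KERNEL ONLY: theorems, 0 definitions, 0 named facts, 0 sorry.  Cell `hodgecm-mathlib`, crux H413, programme P3b line L1′ «KeysPnUnitary»
(`Cruxes/H413/Lines/F0_P3b_KeysPnUnitaryPaydown.lean`), stub U1a′: the generic half — the CM instance is the Theorems-side sequel
`Theorems/F0P3bOmegaLocUnitarizable.lean`.

THE MATHEMATICS [Weil1964 Chap. I n° 11–13; MoeglinVignerasWaldspurger1987 Chap. 2 II.1–II.2].  Let `X` be a topological space with a measure `ν` that is
finite on compact sets and charges every non-empty open set (e.g. a Haar measure on a locally compact group), and let `ρ : G → GL(𝒮(X))` act on the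
Schwartz–Bruhat space (locally constant, compactly supported functions) by `L²(ν)`-ISOMETRIES (★ `Representation.IsL2Isometric ν ρ`: `‖ρ(g)Φ‖₂ = ‖Φ‖₂`).
Then `ρ` is UNITARIZABLE in the algebraic sense of ★ `Representation.IsUnitarizable` (an invariant positive-definite Hermitian form on the representation
space itself, no completion): the form is the `L²` pairing `B(Φ, Ψ) = ∫ Ψ Φ̄ dν` — sesquilinear (conjugate-linear in `Φ`), Hermitian (`conj ∫ Ψ Φ̄ = ∫ Φ Ψ̄`),
POSITIVE DEFINITE on `𝒮(X)` (★ `l2NormSq_pos`: a non-zero locally constant function is a non-zero constant on a non-empty open set, which `ν` charges;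
★ `integral_mul_conj_self_eq_toReal_l2NormSq`), and `ρ`-INVARIANT by polarisation of the isometry (★ `IsL2Isometric.integral_mul_conj_apply`).

* `Representation.IsL2Isometric.isUnitarizable (h : ρ.IsL2Isometric ν) : ρ.IsUnitarizable`.

References: [Weil1964] A. Weil, Acta Math. 111 (1964), Chap. I n° 11–13; [MoeglinVignerasWaldspurger1987] LNM 1291, Chap. 2 II.1–II.2 (the Schrödinger model
is unitary); [BushnellHenniart2006] §1.1, §2.6.
HONEST LABEL (cell): HC_CM is proved only modulo the printed citations until rung 0 closes.
-/

set_option autoImplicit false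

noncomputable section

open MeasureTheory
open scoped ENNReal ComplexConjugate

namespace Literature.NumberTheory.Automorphic

/-- **An `L²(ν)`-isometric action on `𝒮(X)` is unitarizable** (`ν` finite on compacts and positive on non-empty open sets): the `L²` pairing
`B(Φ, Ψ) = ∫ Ψ Φ̄ dν` is a `ρ`-invariant positive-definite Hermitian form on `𝒮(X)`.
[cite: Weil1964, Chap. I n° 13] [cite: MoeglinVignerasWaldspurger1987, Chap. 2 II.2] -/
theorem _root_.Representation.IsL2Isometric.isUnitarizable {X : Type*} [TopologicalSpace X] [MeasurableSpace X] [OpensMeasurableSpace X]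
    {ν : Measure X} [IsFiniteMeasureOnCompacts ν] [ν.IsOpenPosMeasure] {G : Type*} [Group G]
    {ρ : Representation ℂ G (SchwartzBruhat X)} (h : ρ.IsL2Isometric ν) : ρ.IsUnitarizable := by
  refine ⟨LinearMap.mk₂'ₛₗ (starRingEnd ℂ) (RingHom.id ℂ)
      (fun Φ Ψ : SchwartzBruhat X => ∫ x, ((Ψ : SchwartzBruhat X) : X → ℂ) x * conj (((Φ : SchwartzBruhat X) : X → ℂ) x) ∂ν)
      (fun Φ Φ' Ψ => ?_) (fun a Φ Ψ => ?_) (fun Φ Ψ Ψ' => ?_) (fun a Φ Ψ => ?_), ⟨fun Φ Ψ => ?_⟩, fun Φ hΦ => ?_, fun g Φ Ψ => ?_⟩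
  · -- additive in the conjugated variable
    rw [← integral_add (SchwartzBruhat.integrable_mul_conj ν Ψ Φ) (SchwartzBruhat.integrable_mul_conj ν Ψ Φ')]
    refine integral_congr_ae (Filter.Eventually.of_forall fun x => ?_)
    simp only [Submodule.coe_add, Pi.add_apply, map_add, mul_add]
  · -- conjugate-linear in the conjugated variable
    rw [smul_eq_mul, ← integral_const_mul]
    refine integral_congr_ae (Filter.Eventually.of_forall fun x => ?_)
    simp only [Submodule.coe_smul, Pi.smul_apply, smul_eq_mul, map_mul]
    ring
  · -- additive in the linear variable
    rw [← integral_add (SchwartzBruhat.integrable_mul_conj ν Ψ Φ) (SchwartzBruhat.integrable_mul_conj ν Ψ' Φ)]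
    refine integral_congr_ae (Filter.Eventually.of_forall fun x => ?_)
    simp only [Submodule.coe_add, Pi.add_apply, add_mul]
  · -- linear in the linear variable
    rw [RingHom.id_apply, smul_eq_mul, ← integral_const_mul]
    refine integral_congr_ae (Filter.Eventually.of_forall fun x => ?_)
    simp only [Submodule.coe_smul, Pi.smul_apply, smul_eq_mul]
    ring
  · -- Hermitian symmetry: `conj ∫ Ψ Φ̄ = ∫ Φ Ψ̄`
    change conj (∫ x, ((Ψ : SchwartzBruhat X) : X → ℂ) x * conj (((Φ : SchwartzBruhat X) : X → ℂ) x) ∂ν) =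
      ∫ x, ((Φ : SchwartzBruhat X) : X → ℂ) x * conj (((Ψ : SchwartzBruhat X) : X → ℂ) x) ∂ν
    rw [← integral_conj]
    refine integral_congr_ae (Filter.Eventually.of_forall fun x => ?_)
    simp only [map_mul, Complex.conj_conj, mul_comm]
  · -- positive definite: `re ∫ Φ Φ̄ = ‖Φ‖²₂ > 0` for `Φ ≠ 0`
    change 0 < (∫ x, ((Φ : SchwartzBruhat X) : X → ℂ) x * conj (((Φ : SchwartzBruhat X) : X → ℂ) x) ∂ν).re
    rw [SchwartzBruhat.integral_mul_conj_self_eq_toReal_l2NormSq ν Φ, Complex.ofReal_re]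
    exact ENNReal.toReal_pos (SchwartzBruhat.l2NormSq_pos ν hΦ).ne' (SchwartzBruhat.l2NormSq_ne_top ν Φ)
  · -- invariance, by polarisation of the isometry
    exact h.integral_mul_conj_apply g Ψ Φ

end Literature.NumberTheory.Automorphic

end
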